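import Literature.Barriers.BirchSwinnertonDyer.RankNotSumOfLocalInvariantsF5Quintic
import Literature.Barriers.BirchSwinnertonDyer.RankNotSumOfLocalInvariantsF3Cubic
import Literature.Barriers.BirchSwinnertonDyer.RankNotSumOfLocalInvariants480a1RankProofs
import Literature.NumberTheory.EllipticCurves.CyclicPrimeDegreeRank
import Mathlib.FieldTheory.Galois.Abelian
import HarnessLib

/-!
# Barrier (BirchSwinnertonDyer), rank mod `n`: `rk E(F₅) = 1`, `rk E(F₃) = 1` from WEAK subfield bounds

Third file of the independent line (Artin formalism) towards the rank leaf
`Literature.Barriers.BirchSwinnertonDyer.DokchitserDokchitser2011_mordellWeilRank_480a1_F5` —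
`rk_ℤ E(F₅) = 1` for `E = 480a1 : y² = x(x+2)(x-3)` and `F₅` = "the degree 25 subfield of
`ℚ(ζ₁₁, ζ₂₄₁)`" of the proof of Theorem 2 of T. Dokchitser–V. Dokchitser, *A note on the
Mordell–Weil rank modulo `n`*, J. Number Theory 131 (2011) 1833–1839 (arXiv:0910.4588): "2-descent
shows that `rk E/F₃ = rk E/F₅ = 1` […] (e.g. using Magma, over all minimal non-trivial subfields of
`F_n`)" — after

* `Literature/NumberTheory/EllipticCurves/CyclicPrimeDegreeRank.lean`: for `K/ℚ` Galois of prime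
  degree `ℓ`, `rk E(K) = rk E(ℚ) + (ℓ - 1) d` (the `ℓ - 1` faithful characters of `C_ℓ` are
  conjugate over `ℚ`);
* `RankNotSumOfLocalInvariants480a1RankProofs.lean`: `rk E(ℚ) = 1` for `E = 480a1`, by the complete
  `2`-descent over `ℚ` carried out in Lean.

Consequently, over each of the six quintic subfields `K = F₅^{⟨σ⟩}` (`σ ≠ 1`; `Gal(F₅/ℚ) ≅ C₅ × C₅`,
`RankNotSumOfLocalInvariantsF5Quintic.lean`) one has `rk E(K) ∈ {1, 5, 9, …}`, so the WEAK bound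
`rk E(K) ≤ 4` — for a `2`-descent: `dim_{𝔽₂} Sel₂(E/K) ≤ 6` instead of `≤ 3` — already gives
`rk E(K) = 1`, and the `C₅ × C₅` Galois descent of `RankNotSumOfLocalInvariantsCpCpProofs.lean` yields
`rk E(F₅) = 1`. The same argument with `ℓ = 3` (`rk E(K) ∈ {1, 3, 5, …}` over the four cubic
subfields `K ⊂ F₃`, `RankNotSumOfLocalInvariantsF3Cubic.lean`) turns the weak cubic bounds
`rk E(K) ≤ 2` into `rk E(F₃) = 1`.

| statement | declaration | status |
|---|---|---|
| `|Aut(F/ℚ)| = p²`, exponent `p`, `rk E(ℚ) = 1`, `K_σ/ℚ` Galois of degree `p` covering `F^σ` with `rk E(K_σ) ≤ p - 1` ⟹ `rk E(F) = 1` | `DokchitserDokchitser2011.mordellWeilRank_baseChange_eq_one_of_exponent_prime_of_le` | proved |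
| `rk E(F₅^{⟨σ⟩}) ≤ 4` for all `σ ≠ 1` ⟹ `rk E(F5 K) = 1` (`K` any `2651`-st cyclotomic extension of `ℚ`) | `DokchitserDokchitser2011.F5.mordellWeilRank_curve480a1_eq_one_of_quintic_le_four` | proved |
| the rank leaf and the `n = 5` fact from the weak quintic bounds | `DokchitserDokchitser2011_mordellWeilRank_480a1_F5_of_quintic_le_four`, `DokchitserDokchitser2011_rank_480a1_F5_of_quintic_le_four` | proved |
| the weak quintic bounds themselves (`2`-Selmer computations over six cyclic quintic fields) | hypothesis `h`, written out | NOT formalised; no new named fact (the debt stays with the rank leaf, to which `h` is equivalent by `DokchitserDokchitser2011_mordellWeilRank_480a1_F5_iff_quintic`) |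
| `n = 3` twin: `rk E(K_σ) ≤ 2` for the four cubic `K_σ ⊂ F₃` ⟹ `rk E(F₃) = 1` ⟹ the `n = 3` fact | `DokchitserDokchitser2011.F₃.mordellWeilRank_curve480a1_eq_one_of_cubic_le_two`, `DokchitserDokchitser2011_rank_480a1_F3_of_cubic_le_two` | proved |

## Design notes

Theorems only (no definitions, no named facts; D-0026). The quintic subfields are Mathlib's
`IntermediateField.fixedField (Subgroup.zpowers σ)` exactly as in the F5Quintic file; they are
Galois over `ℚ` because `F₅/ℚ` is abelian (`IsCyclotomicExtension.isAbelianGalois`, Mathlib's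
instance `IsAbelianGalois ℚ ↥K'` for intermediate fields, `IsGalois.of_fixedField_normal_subgroup`).
The specialisation to `K = CyclotomicField 2651 ℚ` and the `F5` theorem are elaborated under
`set_option backward.isDefEq.respectTransparency false`, crossing the `ℚ`-algebra instance diamond
on cyclotomic / intermediate fields the same way as `RankNotSumOfLocalInvariantsF5.lean` and
`RankNotSumOfLocalInvariantsF5Quintic.lean`. What is NOT here: any `2`-descent over a quintic field
(no `S`-unit or class-group computation of a number field `≠ ℚ` exists in Lean).

## References

* T. Dokchitser, V. Dokchitser, *A note on the Mordell–Weil rank modulo `n`*, J. Number Theory 131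
  (2011) 1833–1839, arXiv:0910.4588: proof of Thm. 2 (p. 3 of the held arXiv copy).
  [DokchitserDokchitser2011RankModN]
* J. H. Silverman, *The Arithmetic of Elliptic Curves*, 2nd ed., GTM 106 (2009), Thm. VIII.6.7,
  Ch. X §1. [SilvermanAEC2009]
-/

noncomputable section

open scoped Classical NumberField

open NumberField WeierstrassCurve IntermediateField

namespace Literature.Barriers.BirchSwinnertonDyer

namespace DokchitserDokchitser2011

/-- **Rank `1` by descent through `C_p × C_p`, from weak bounds over the degree-`p`
subfields.** Let `F` be a number field with `|Aut(F/ℚ)| = p²` of exponent `p` (`p` prime),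
`E/ℚ` an elliptic curve (model `W`) with a rational point of infinite order and
`rank_ℤ E(ℚ) = 1`, and suppose that the fixed field of each `σ ≠ 1` is covered by a number field
`K_σ → F` which is Galois of degree `p` over `ℚ` with `rank_ℤ E(K_σ) ≤ p - 1`. Then
`rank_ℤ E(F) = 1`. Indeed `rank E(K_σ) = rank E(ℚ) + (p - 1) d = 1 + (p - 1) d`
(`WeierstrassCurve.exists_mordellWeilRank_baseChange_eq_add_mul_of_prime`, the Artin formalism
for `Gal(K_σ/ℚ) ≅ C_p`), so `rank E(K_σ) ≤ p - 1` forces `d = 0` and `rank E(K_σ) = 1`, and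
`mordellWeilRank_baseChange_eq_one_of_exponent_prime` (descent through `C_p × C_p`) applies.
For `p = 5` and `F = F₅` this reduces "2-descent shows that `rk E/F₅ = 1` (e.g. using Magma,
over all minimal non-trivial subfields of `F_n`)" to the bounds `rk E(K) ≤ 4` over the six
quintic subfields `K ⊂ F₅` together with `rk E(ℚ) = 1`
(`curve480a1.mordellWeilRank_eq_one`). [folklore] -/
theorem mordellWeilRank_baseChange_eq_one_of_exponent_prime_of_le {F : Type} [Field F]
    [NumberField F] (W : WeierstrassCurve ℚ) [W.IsElliptic] {p : ℕ} (hp : p.Prime)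
    (hcardp : Nat.card (F ≃ₐ[ℚ] F) = p ^ 2) (hexp : ∀ σ : F ≃ₐ[ℚ] F, σ ^ p = 1)
    (hP : ∃ P : (W.baseChange ℚ).toAffine.Point, ∀ n : ℕ, 0 < n → n • P ≠ 0)
    (hQ : (W.baseChange ℚ).mordellWeilRank = 1)
    (hK : ∀ σ : F ≃ₐ[ℚ] F, σ ≠ 1 →
      ∃ (K : Type) (_ : Field K) (_ : NumberField K) (_ : Algebra ℚ K) (f : K →ₐ[ℚ] F),
        IsGalois ℚ K ∧ Module.finrank ℚ K = p ∧ (∀ x : F, σ x = x → x ∈ f.range) ∧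
          (W.baseChange K).mordellWeilRank ≤ p - 1) :
    (W.baseChange F).mordellWeilRank = 1 := by
  refine mordellWeilRank_baseChange_eq_one_of_exponent_prime W hp hcardp hexp hP fun σ hσ => ?_
  obtain ⟨K, iF, iN, iA, f, hG, hdeg, hcov, hrk⟩ := hK σ hσ
  haveI := hG
  obtain ⟨d, hd⟩ := W.exists_mordellWeilRank_baseChange_eq_add_mul_of_prime K hp hdeg
  refine ⟨K, iF, iN, iA, f, hcov, ?_⟩
  rw [hd, hQ] at hrk ⊢
  have hp2 := hp.two_le
  rcases d with _ | d
  · simp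
  · exfalso
    have : p - 1 ≤ (p - 1) * (d + 1) := Nat.le_mul_of_pos_right _ d.succ_pos
    omega

variable (K : Type) [Field K] [NumberField K] [IsCyclotomicExtension {2651} ℚ K]

set_option backward.isDefEq.respectTransparency false in
/-- **`rk E(F₅) = 1` from the WEAK quintic bounds `rk E(F₅^{⟨σ⟩}) ≤ 4`.** For `E = 480a1` and
`F₅ = F5 K` ("the degree 25 subfield of `ℚ(ζ₁₁, ζ₂₄₁)`", `Gal(F₅/ℚ) ≅ C₅ × C₅`: `F5.card_aut`,
`F5.algEquiv_pow_five`), if `rk_ℤ E(F₅^{⟨σ⟩}) ≤ 4` for each of the six quintic subfields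
`F₅^{⟨σ⟩}`, `σ ≠ 1` (Galois over `ℚ` with group `C₅`, as `F₅/ℚ` is abelian;
`F5.finrank_fixedField_zpowers`), then `rk_ℤ E(F₅) = 1`: by the Artin formalism
`rk E(F₅^{⟨σ⟩}) = rk E(ℚ) + 4d` with `rk E(ℚ) = 1` (`curve480a1.mordellWeilRank_eq_one`, the
complete `2`-descent over `ℚ`), so `rk E(F₅^{⟨σ⟩}) = 1`, and the `C₅ × C₅` descent of
`RankNotSumOfLocalInvariantsCpCpProofs.lean` concludes
(`mordellWeilRank_baseChange_eq_one_of_exponent_prime_of_le`). Compared with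
`F5.mordellWeilRank_curve480a1_eq_one_of_quintic` (hypothesis `≤ 1`), the six computer
`2`-descents of the source now only need to deliver `dim_{𝔽₂} Sel₂(E/F₅^{⟨σ⟩}) ≤ 6` instead of
`≤ 3`. [cite: DokchitserDokchitser2011RankModN, proof of Thm. 2] -/
theorem F5.mordellWeilRank_curve480a1_eq_one_of_quintic_le_four
    (h : ∀ σ : Gal((F5 K)/ℚ), σ ≠ 1 →
      (curve480a1.baseChange (fixedField (Subgroup.zpowers σ))).mordellWeilRank ≤ 4) :
    (curve480a1.baseChange (F5 K)).mordellWeilRank = 1 := by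
  haveI := IsCyclotomicExtension.isAbelianGalois {2651} ℚ K
  haveI : IsAbelianGalois ℚ (F5 K) := inferInstance
  haveI : ∀ σ : Gal((F5 K)/ℚ), IsGalois ℚ (fixedField (Subgroup.zpowers σ)) := fun σ =>
    IsGalois.of_fixedField_normal_subgroup (Subgroup.zpowers σ)
  exact mordellWeilRank_baseChange_eq_one_of_exponent_prime_of_le (F := F5 K) curve480a1
    Nat.prime_five (F5.card_aut K) (F5.algEquiv_pow_five K) curve480a1.exists_nsmul_ne_zero
    curve480a1.mordellWeilRank_eq_one
    fun σ hσ => ⟨fixedField (Subgroup.zpowers σ), inferInstance, inferInstance, inferInstance,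
      (fixedField (Subgroup.zpowers σ)).val, inferInstance, F5.finrank_fixedField_zpowers K hσ,
      fun x hx => ⟨⟨x, F5.mem_fixedField_zpowers_of_apply_eq K hx⟩, rfl⟩, h σ hσ⟩

end DokchitserDokchitser2011

open DokchitserDokchitser2011

set_option backward.isDefEq.respectTransparency false in
/-- **The rank leaf `rk E(F₅) = 1` from the weak quintic bounds** (approach independent of the
sharp quintic `2`-descents): the tree's named fact
`DokchitserDokchitser2011_mordellWeilRank_480a1_F5` — `rk_ℤ E(F₅) = 1` for `E = 480a1` and
`F₅ = DokchitserDokchitser2011.F5 (CyclotomicField 2651 ℚ)` — follows from `rk_ℤ E(F₅^{⟨σ⟩}) ≤ 4`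
over the six quintic subfields `F₅^{⟨σ⟩}`, `σ ≠ 1`; everything else (`C₅ × C₅`, the Artin
formalism for `C₅`, `rk E(ℚ) = 1` by `2`-descent over `ℚ`, Mordell–Weil) is a theorem of the
tree. With `DokchitserDokchitser2011_mordellWeilRank_480a1_F5_iff_quintic` the hypotheses
"`≤ 4` for all `σ ≠ 1`" and "`≤ 1` for all `σ ≠ 1`" are both equivalent to the leaf.
[cite: DokchitserDokchitser2011RankModN, proof of Thm. 2] -/
theorem DokchitserDokchitser2011_mordellWeilRank_480a1_F5_of_quintic_le_four
    (h : ∀ σ : Gal((F5 (CyclotomicField 2651 ℚ))/ℚ), σ ≠ 1 →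
      (curve480a1.baseChange (fixedField (Subgroup.zpowers σ))).mordellWeilRank ≤ 4) :
    DokchitserDokchitser2011_mordellWeilRank_480a1_F5 :=
  F5.mordellWeilRank_curve480a1_eq_one_of_quintic_le_four (CyclotomicField 2651 ℚ) h

set_option backward.isDefEq.respectTransparency false in
/-- **The `n = 5` witness of Theorem 2 from the weak quintic bounds**: the tree's named fact
`DokchitserDokchitser2011_rank_480a1_F5` (the field `F₅`, its splitting, `rk E(F₅) = 1`) follows
from `rk E(F₅^{⟨σ⟩}) ≤ 4` for the six quintic subfields (through
`DokchitserDokchitser2011_rank_480a1_F5_of_mordellWeilRank` of the F5 file).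
[cite: DokchitserDokchitser2011RankModN, proof of Thm. 2] -/
theorem DokchitserDokchitser2011_rank_480a1_F5_of_quintic_le_four
    (h : ∀ σ : Gal((F5 (CyclotomicField 2651 ℚ))/ℚ), σ ≠ 1 →
      (curve480a1.baseChange (fixedField (Subgroup.zpowers σ))).mordellWeilRank ≤ 4) :
    DokchitserDokchitser2011_rank_480a1_F5 :=
  DokchitserDokchitser2011_rank_480a1_F5_of_mordellWeilRank
    (DokchitserDokchitser2011_mordellWeilRank_480a1_F5_of_quintic_le_four h)

/-! ### `n = 3`: `rk E(F₃) = 1` from the weak cubic bounds `rk E(K_σ) ≤ 2` -/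

namespace DokchitserDokchitser2011

open Cyclotomic1339 in
set_option backward.isDefEq.respectTransparency false in
/-- **`rk E(F₃) = 1` from the WEAK cubic bounds `rk E(K_σ) ≤ 2`** (`n = 3` twin): for `E = 480a1`
and `F₃` = "the degree 9 subfield of `ℚ(ζ₁₃, ζ₁₀₃)`" (`Gal(F₃/ℚ) ≅ C₃ × C₃`: `F₃.card_aut`,
`F₃.algEquiv_pow_three`), if `rk_ℤ E(K_σ) ≤ 2` for each of the four cubic subfields
`K_σ = F₃^{⟨σ⟩}`, `σ ≠ 1` (`F₃.cubicField`; Galois over `ℚ` with group `C₃`, as `F₃/ℚ` is abelian;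
`F₃.finrank_cubicField`), then `rk_ℤ E(F₃) = 1`: `rk E(K_σ) = rk E(ℚ) + 2d = 1 + 2d ≤ 2` forces
`d = 0`. Compared with `DokchitserDokchitser2011_descent_480a1_F3_of_cubic` (hypothesis `≤ 1`, the
named fact `DokchitserDokchitser2011_descent_480a1_F3_cubic`), the four cubic `2`-descents of the
source now only need `dim_{𝔽₂} Sel₂(E/K_σ) ≤ 4` instead of `≤ 3`.
[cite: DokchitserDokchitser2011RankModN, proof of Thm. 2] -/
theorem F₃.mordellWeilRank_curve480a1_eq_one_of_cubic_le_two
    (h : ∀ σ : Gal(F₃/ℚ), σ ≠ 1 → (curve480a1.baseChange (F₃.cubicField σ)).mordellWeilRank ≤ 2) :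
    (curve480a1.baseChange F₃).mordellWeilRank = 1 := by
  haveI : IsAbelianGalois ℚ F₃ := inferInstance
  haveI : ∀ σ : Gal(F₃/ℚ), IsGalois ℚ (F₃.cubicField σ) := fun σ =>
    IsGalois.of_fixedField_normal_subgroup (Subgroup.zpowers σ)
  exact mordellWeilRank_baseChange_eq_one_of_exponent_prime_of_le (F := F₃) curve480a1
    Nat.prime_three (F₃.card_aut.trans (by norm_num)) F₃.algEquiv_pow_three
    curve480a1.exists_nsmul_ne_zero curve480a1.mordellWeilRank_eq_one
    fun σ hσ => ⟨F₃.cubicField σ, inferInstance, inferInstance, inferInstance,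
      (F₃.cubicField σ).val, inferInstance, F₃.finrank_cubicField hσ,
      fun x hx => ⟨⟨x, F₃.mem_cubicField_of_apply_eq hx⟩, rfl⟩, h σ hσ⟩

end DokchitserDokchitser2011

/-- **The `n = 3` witness of Theorem 2 from the weak cubic bounds**: the tree's named fact
`DokchitserDokchitser2011_rank_480a1_F3` (the field `F₃`, its splitting, `rk E(F₃) = 1`) follows
from `rk E(K_σ) ≤ 2` for the four cubic subfields (through
`DokchitserDokchitser2011_rank_480a1_F3_of_descent` of the F3 file).
[cite: DokchitserDokchitser2011RankModN, proof of Thm. 2] -/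
theorem DokchitserDokchitser2011_rank_480a1_F3_of_cubic_le_two
    (h : ∀ σ : Gal(F₃/ℚ), σ ≠ 1 → (curve480a1.baseChange (F₃.cubicField σ)).mordellWeilRank ≤ 2) :
    DokchitserDokchitser2011_rank_480a1_F3 :=
  DokchitserDokchitser2011_rank_480a1_F3_of_descent
    (F₃.mordellWeilRank_curve480a1_eq_one_of_cubic_le_two h)

end Literature.Barriers.BirchSwinnertonDyer

end
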